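import Literature.MathematicalPhysics.QuantumFieldTheory.Balaban1983to89.B8Eq191FlatLettersExplicitRec
import Literature.MathematicalPhysics.QuantumFieldTheory.Balaban1983to89.B8Eq191FlatLettersRDOfReal

/-!
# `Balaban1983to89.B8Eq191FlatLettersRDOfRealRec` — [Balaban1985BackgroundPropagators] Thms 3.1–3.2 ∕ [Balaban1985RegularSpaces] (1.91)–(1.101) AT `U₀ = 1` FOR THE RECORD's AVERAGING
# STRUCTURE ([Balaban1987RG1] (0.3)): the complete [4]-letters block of the join on a finite Dirichlet region FROM THREE REAL INEQUALITY FAMILIES on the explicit matrices — the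
# record twin of `B8Eq191FlatLettersRDOfReal` (R6, δ sub-chain; LEAD PEN dag-n05-e)

statement-level skeleton of published theorems with citation tags; proofs where landed; nothing here is a claim about the Yang–Mills mass gap

CITATION HEADER (lean-in-tree rule).  Cell `pub-ymgap` (D-0062), «N05-REC» road (director-ym №254∕№255; LEAD PEN dag-n05-e g37; desk `R6-PLAN.md` §2 (d)).  [6] = [Balaban1985RegularSpaces]
(1.91)–(1.92) p. 91, (1.95)–(1.98) p. 92, (1.101) p. 93, p. 96, Prop. 5 p. 94, Prop. 6 p. 99; [4] = [Balaban1985BackgroundPropagators] Thm 3.1 p. 397, Thm 3.2 p. 398, (3.23)–(3.25) p. 394; [B6] =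
[Balaban1984PropagatorsII] p. 235; [I] = [Balaban1987RG1] (0.3) p. 252.  `--kind proof --supports stmt-QuantumFields-20541` (K0⁷; count-neutral; no definition).  TOKEN MAP as in
`B8Eq191FlatLettersDirichletRec`; record inputs `B8Eq191FlatLettersExplicitRec.exists_flatLettersZ_dirichlet_explicit`, `B8Eq191FlatStencilsRec.QprimeIterZ_flat_eq_sum_of_supp`,
`B8Eq191FlatLettersDirichletRec.tower_sum_eq_bm`, dag-n05-d's `QTZ_flat_apply`; class-0 (no block geometry) `B8Eq191FlatBoundsTransfer.{hG_flat_of_real, hH_flat_of_real, hRbd_flat_of_real}`,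
`kernel_comp`, `XSpace`, `Bd2`, `wt` reused BY NAME; proof text otherwise byte-identical to the engine's.
WHAT IS PROVED (sorry-free).  ★★ `flatLettersZRD_of_real` — from the three real inequality families `realG` ((1.101) for `T⁻¹`), `realH` ((1.92) + the p. 93 `Δ`-entry for
`T⁻¹(T⁻¹Qᵀ)(QT⁻¹T⁻¹Qᵀ)⁻¹`), `realR` ((1.98) for `1 − T⁻¹Qᵀ(QT⁻¹T⁻¹Qᵀ)⁻¹QT⁻¹`) on the explicit matrices of the RECORD blocking (labels `flmZ L j`, odd `L`): the sixteen binders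
`g_rightΩ c_range hΔ hqs hq hH0 hH1 hH2 hHsupp hHequiv hQH hG hGsupp hGreal hRbd hRreal` of the record's letters socket at `U₀ := 1`, truncation `n`, structure `Λs`.
HONEST SCOPE.  Finite linear algebra + transfer of real bounds at the flat background; the three real families are HYPOTHESES (the [4] estimates are not asserted); nothing of [4]∕[6]∕[B6]∕[I]
asserted beyond it; `HThm4Rec` UNDISCHARGED; N05 ∕ N07 NOT discharged; counts unmoved; one finite 𝕋⁴ programme at fixed ε — nothing continuum ∕ ℝ⁴ ∕ OS ∕ mass gap ∕ Clay.  No `def`,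
no `instance`, no `notation`, no `sorry`.
-/

noncomputable section

namespace Literature.MathematicalPhysics.QuantumFieldTheory.Balaban1983to89.B8Eq191FlatLettersRDOfRealRec

open Finset
open scoped Matrix
open B7Prop1Explicit (e)
open B7Eq78Linearization (QprimeIter)
open B7SectEFLinearisationRec (zdBlockingZ bgTZ)
open B8Ineq132 (covDerivFwd)
open B8Eq119TwistedAxialRec (flmZ)
open B8Eq138LandauZd (covLap)
open B8Eq138LandauZdRec (QTZ)
open B8Eq138LandauFlatOrthogonalRec (QTZ_flat_apply)
open B8Eq140Level (SideTouches)
open B8Eq1117Concrete (XSpace)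
open B8Prop5ContractionKLevel (Bd2)
open B8LambdaSpaceKLevel (wt)
open B8Eq191FlatStencilsRec (QprimeIterZ_flat_eq_sum_of_supp QprimeIter_bgTZ_one)
open B8Eq191FlatLettersDirichlet (kernel_comp)
open B8Eq191FlatLettersDirichletRec (tower_sum_eq_bm)
open B8Eq191FlatLettersExplicitRec (exists_flatLettersZ_dirichlet_explicit)
open B8Eq191FlatBoundsTransfer (hG_flat_of_real hH_flat_of_real hRbd_flat_of_real)

-- `Site` alone could resolve to the torus sites of `Setup.lean`; re-export the `ℤ^d` sites of `B7Prop1Explicit`.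
export B7Prop1Explicit (Site)

variable {d : ℕ}

section Letters

variable {𝔸 : Type*} [CStarAlgebra 𝔸]

open Classical in
/-- ★★ (RECORD TWIN of `flatLettersRD_of_real`: centred blocking `zdBlockingZ ∕ bgTZ ∕ QTZ`, labels `flmZ`, odd `L`.) **THE COMPLETE [4]-LETTERS BLOCK OF THE JOIN AT `U₀ = 1` ON A
FINITE DIRICHLET REGION FOR THE RECORD's AVERAGING, FROM THREE REAL INEQUALITY FAMILIES ON THE EXPLICIT MATRICES.**  DATA (as `B8Eq191FlatLettersExplicit.exists_flatLetters_dirichlet_explicit`): `d ≥ 1`, `η > 0`, `L ≥ 1`, a truncation `n`, level regions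
`Ω_j ⊆ Ω₀ = Ω 0` (`j ≤ n`), a structure `{Λ_j}_{j ≤ n}` whose tower blocks are pairwise disjoint on `Ω₀` and meet `Ω₀`, weights `a_j ≥ 0`; the region
listed by `S`, the tower index set `𝔅 = {(j,y) ∣ j ≤ n, y ∈ Λ_j}` by `B`, the flat kernel `K = η⁻²(2d·δ − Σ_μ(δ_{+μ} + δ_{−μ})) + Σ_j a_jL^{−2dj}[y_j(z)
= y_j(x) ∈ Λ_j]`, the matrices `T = (K(x,z))_{x,z∈Ω₀}`, `Q = (L^{−dj}[y_j(z) = y])`.  HYPOTHESES — THREE FAMILIES OF INEQUALITIES FOR REAL LATTICE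
FUNCTIONS (the currency of [4] Thms 3.1–3.2 at `U = 1`): `realG` = (1.101) for `T⁻¹` (for every real `ρ` on `Ω₀` with the `(−2)`-profile `≤ r` on
the `Ω_j`, the field `φ = T⁻¹ρ` (extended by `0`) has `|φ| ≤ B_G r` and `(Lʲη)|η⁻¹(φ(x + e_μ) − φ(x))| ≤ B_G r` on the sides of the plaquettes
touching `Ω_j`); `realH` = (1.92) + the p. 93 `Δ`-entry for `T⁻¹(T⁻¹Qᵀ)(QT⁻¹T⁻¹Qᵀ)⁻¹` (for every real `X` on `𝔅` with `|X| ≤ s`: `|φ| ≤ B′₀s`,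
`(Lʲη)|∇φ| ≤ B′₀s` on the sides touching `Ω_j`, `(Lʲη)²|Δ^η φ| ≤ B₂′s` on `Ω_j`); `realR` = (1.98) for `1 − T⁻¹Qᵀ(QT⁻¹T⁻¹Qᵀ)⁻¹QT⁻¹`
(`(Lʲη)²|ρ(w) − Σ_z(…)(w,z)ρ(z)| ≤ B_R r` on `Ω_j`).  CONCLUSION — VERBATIM THE BODY OF `B8SockLettersRD.SockLettersRD` AT BACKGROUND `1`,
TRUNCATION `n`, STRUCTURE `Λs`: seven letters `g Δ q qs Aw c H′` with `g_rightΩ`, `c_range`, `hΔ`, `hqs`, `hq`, `hH0`, `hH1`, `hH2`, `hHsupp`,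
`hHequiv`, `hQH`, `hG`, `hGsupp`, `hGreal`, `hRbd`, `hRreal` — the sixteen binders of `B8SockHFPRD.sockHFP_body_of_join_RD` at `U₀ := 1`.  PROOF:
the letters and eleven laws from file 6; the composite kernel of `G′QᵀCQG′` is `T⁻¹·Qᵀ·(QT⁻²Qᵀ)⁻¹·Q·T⁻¹` (kernel algebra); the five bounds by
`B8Eq191FlatBoundsTransfer` (real kernel ⊗ id).
[cite: Balaban1985RegularSpaces, (1.91)–(1.92) p.91, (1.95)–(1.98) p.92, (1.101) p.93, p.96 («Q′H′ = I»), Prop. 5 p.94; Balaban1985BackgroundPropagators, Thm 3.1 p.397, Thm 3.2 p.398, (3.23)–(3.25) p.394; Balaban1984PropagatorsII, p.235] -/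
theorem flatLettersZRD_of_real (hd : 0 < d) {η : ℝ} (hη : 0 < η) {L : ℕ} (hLo : Odd L) (n : ℕ) (Ω : ℕ → Set (Site d))
    (hΩ0 : ∀ j, j ≤ n → Ω j ⊆ Ω 0) (Λs : ℕ → Set (Site d)) (a : ℕ → ℝ) (ha : ∀ j, 0 ≤ a j)
    (S : Finset (Site d)) (hS : ∀ w, w ∈ S ↔ w ∈ Ω 0)
    (hmeet : ∀ j, j ≤ n → ∀ y ∈ Λs j, ∃ z ∈ Ω 0, flmZ L j z = y)
    (hdisj : ∀ j, j ≤ n → ∀ j', j' ≤ n → ∀ y ∈ Λs j, ∀ y' ∈ Λs j', ∀ z ∈ Ω 0,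
      flmZ L j z = y → flmZ L j' z = y' → j = j' ∧ y = y')
    (B : Finset (ℕ × Site d)) (hB : ∀ p, p ∈ B ↔ p.1 ≤ n ∧ p.2 ∈ Λs p.1)
    (K : Site d → Site d → ℝ)
    (hK : ∀ x z, K x z = ((η ^ 2)⁻¹ * ∑ μ : Fin d, ((2 : ℝ) * (if z = x then (1 : ℝ) else 0) - (if z = x + e μ then (1 : ℝ) else 0)
      - (if z = x - e μ then (1 : ℝ) else 0))) +
      (∑ j ∈ Finset.range (n + 1), (if flmZ L j x ∈ Λs j ∧ flmZ L j z = flmZ L j x then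
        a j * ((((L : ℝ) ^ d)⁻¹) ^ j) ^ 2 else 0)))
    (T : Matrix ↥S ↥S ℝ) (hT : T = Matrix.of fun x z : ↥S => K x.1 z.1)
    (Q : Matrix ↥B ↥S ℝ)
    (hQ : Q = Matrix.of fun (p : ↥B) (z : ↥S) => if flmZ L p.1.1 z.1 = p.1.2 then (((L : ℝ) ^ d)⁻¹) ^ p.1.1 else 0)
    {BG B₀'H B₂' BR : ℝ}
    -- (1.101) for `T⁻¹`, real lattice functions
    (realG : ∀ (ρ : ↥S → ℝ) (r : ℝ), 0 ≤ r → (∀ j, j ≤ n → ∀ z : ↥S, z.1 ∈ Ω j → wt L η j ^ 2 * |ρ z| ≤ r) →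
      ∀ φ : Site d → ℝ, (∀ x, x ∉ Ω 0 → φ x = 0) → (∀ w : ↥S, φ w.1 = ∑ z : ↥S, T⁻¹ w z * ρ z) →
      (∀ x, |φ x| ≤ BG * r) ∧
      ∀ j, j ≤ n → ∀ p ∈ {b : Site d × Fin d | SideTouches (Ω j) b.1 b.2},
        wt L η j * |η⁻¹ * (φ (p.1 + e p.2) - φ p.1)| ≤ BG * r)
    -- (1.92) and the p. 93 `Δ`-entry for `T⁻¹(T⁻¹Qᵀ)(QT⁻¹T⁻¹Qᵀ)⁻¹`, real `X`
    (realH : ∀ (X : ↥B → ℝ) (s : ℝ), 0 ≤ s → (∀ p', |X p'| ≤ s) →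
      ∀ φ : Site d → ℝ, (∀ x, x ∉ Ω 0 → φ x = 0) →
      (∀ w : ↥S, φ w.1 = ∑ p' : ↥B, (T⁻¹ * (T⁻¹ * Qᵀ) * (Q * T⁻¹ * T⁻¹ * Qᵀ)⁻¹) w p' * X p') →
      (∀ x, |φ x| ≤ B₀'H * s) ∧
      (∀ j, j ≤ n → ∀ p ∈ {b : Site d × Fin d | SideTouches (Ω j) b.1 b.2},
        wt L η j * |η⁻¹ * (φ (p.1 + e p.2) - φ p.1)| ≤ B₀'H * s) ∧
      (∀ j, j ≤ n → ∀ x ∈ Ω j,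
        wt L η j ^ 2 * |∑ μ : Fin d, (η ^ 2)⁻¹ * (2 * φ x - φ (x + e μ) - φ (x - e μ))| ≤ B₂' * s))
    -- (1.98) for `1 − T⁻¹Qᵀ(QT⁻¹T⁻¹Qᵀ)⁻¹QT⁻¹`, real lattice functions
    (realR : ∀ (ρ : ↥S → ℝ) (r : ℝ), 0 ≤ r → (∀ j, j ≤ n → ∀ z : ↥S, z.1 ∈ Ω j → wt L η j ^ 2 * |ρ z| ≤ r) →
      ∀ j, j ≤ n → ∀ w : ↥S, w.1 ∈ Ω j →
        wt L η j ^ 2 * |ρ w - ∑ z : ↥S, (T⁻¹ * (Qᵀ * ((Q * T⁻¹ * T⁻¹ * Qᵀ)⁻¹ * (Q * T⁻¹)))) w z * ρ z| ≤ BR * r) :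
    ∃ (g Δ : (Site d → 𝔸) →ₗ[ℂ] (Site d → 𝔸)) (q : (Site d → 𝔸) →ₗ[ℂ] (ℕ → Site d → 𝔸))
      (qs : (ℕ → Site d → 𝔸) →ₗ[ℂ] (Site d → 𝔸)) (Aw c : (ℕ → Site d → 𝔸) →ₗ[ℂ] (ℕ → Site d → 𝔸))
      (H' : XSpace d n 𝔸 →ₗ[ℂ] (Site d → 𝔸)),
      (∀ x, ∀ y ∈ Ω 0, (Δ (g x) + qs (Aw (q (g x)))) y = x y) ∧ (∀ f, q (g (g (qs (c (q f))))) = q f) ∧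
      (∀ (f : Site d → 𝔸), ∀ x ∈ Ω 0, Δ f x = covLap η (1 : Site d → Fin d → 𝔸ˣ) ((Ω 0).indicator f) x) ∧
      (∀ (μ : ℕ → Site d → 𝔸), ∀ x ∈ Ω 0, qs μ x = QTZ L n Λs (1 : Site d → Fin d → 𝔸ˣ) μ x) ∧
      (∀ (f : Site d → 𝔸) (j : ℕ), j ≤ n → ∀ y ∈ Λs j, q f j y = QprimeIter (zdBlockingZ d L) (bgTZ L (1 : Site d → Fin d → 𝔸ˣ)) j f y) ∧
      (∀ (X : XSpace d n 𝔸) (x : Site d), ‖H' X x‖ ≤ B₀'H * ‖X‖) ∧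
      (∀ j, j ≤ n → ∀ (X : XSpace d n 𝔸), ∀ p ∈ {b : Site d × Fin d | SideTouches (Ω j) b.1 b.2},
        wt L η j * ‖covDerivFwd η (1 : Site d → Fin d → 𝔸ˣ) p.2 (H' X) p.1‖ ≤ B₀'H * ‖X‖) ∧
      (∀ X : XSpace d n 𝔸, Bd2 L η n Ω (covLap η (1 : Site d → Fin d → 𝔸ˣ) (H' X)) (B₂' * ‖X‖)) ∧
      (∀ (X : XSpace d n 𝔸) (x : Site d), x ∉ Ω 0 → H' X x = 0) ∧
      (∀ X Y : XSpace d n 𝔸, (∀ p, Y p = -star (X p)) → ∀ x, H' Y x = -star (H' X x)) ∧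
      (∀ (Y : XSpace d n 𝔸) (j : ℕ) (hj : j ≤ n) (y : Site d), y ∈ Λs j →
        QprimeIter (zdBlockingZ d L) (bgTZ L (1 : Site d → Fin d → 𝔸ˣ)) j (H' Y) y = Y (⟨j, Nat.lt_succ_of_le hj⟩, y)) ∧
      (∀ (f : Site d → 𝔸) (r : ℝ), 0 ≤ r → Bd2 L η n Ω f r →
        (∀ x, ‖g f x‖ ≤ BG * r) ∧ ∀ j, j ≤ n → ∀ p ∈ {b : Site d × Fin d | SideTouches (Ω j) b.1 b.2},
          wt L η j * ‖covDerivFwd η (1 : Site d → Fin d → 𝔸ˣ) p.2 (g f) p.1‖ ≤ BG * r) ∧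
      (∀ (f : Site d → 𝔸) (x : Site d), x ∉ Ω 0 → g f x = 0) ∧
      (∀ f : Site d → 𝔸, (∀ j, j ≤ n → ∀ x ∈ Ω j, IsSelfAdjoint (f x)) → ∀ x, IsSelfAdjoint (g f x)) ∧
      (∀ (f : Site d → 𝔸) (r : ℝ), 0 ≤ r → Bd2 L η n Ω f r → Bd2 L η n Ω (f - g (qs (c (q (g f))))) (BR * r)) ∧
      (∀ f : Site d → 𝔸, (∀ j, j ≤ n → ∀ x ∈ Ω j, IsSelfAdjoint (f x)) →
        ∀ j, j ≤ n → ∀ x ∈ Ω j, IsSelfAdjoint ((f - g (qs (c (q (g f))))) x)) := by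
  -- the letters with the eleven laws and the four displayed kernels (g3's file 6)
  obtain ⟨g, Δ, q, qs, Aw, c, H', g_rightΩ, c_range, hΔ, hqs, hq, -, hHsupp, hHequiv, hQH, hGsupp, hGreal₀, hRreal₀, hgker, hcker,
    -, hHker⟩ := exists_flatLettersZ_dirichlet_explicit (𝔸 := 𝔸) hd hη.ne' hLo n Λs a ha (Ω 0) S hS hmeet hdisj B hB K hK T hT Q hQ
  -- §1 the composite kernel of `G′QᵀCQG′`: `T⁻¹·Qᵀ·M⁻¹·Q·T⁻¹`, `M = QT⁻¹T⁻¹Qᵀ`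
  have hg_supp : ∀ (f : Site d → 𝔸) (w : Site d), w ∉ S → g f w = 0 := fun f w hw => hGsupp f w (fun h => hw ((hS w).mpr h))
  have hq_mem : ∀ (u : Site d → 𝔸), (∀ w, w ∉ S → u w = 0) → ∀ p : ↥B, q u p.1.1 p.1.2 = ∑ z : ↥S, (Q p z) • u z.1 := by
    intro u hu p
    have hp := (hB p.1).mp p.2
    rw [hq u p.1.1 hp.1 p.1.2 hp.2, QprimeIter_bgTZ_one, QprimeIterZ_flat_eq_sum_of_supp L hLo S u hu p.1.1 p.1.2, ← Finset.sum_coe_sort S]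
    exact Finset.sum_congr rfl fun z _ => by rw [hQ, Matrix.of_apply]
  have hqg : ∀ (f : Site d → 𝔸) (p : ↥B), q (g f) p.1.1 p.1.2 = ∑ w : ↥S, ((Q * T⁻¹) p w) • f w.1 := by
    intro f p
    rw [hq_mem _ (hg_supp f) p, Finset.sum_congr rfl fun z _ => by rw [hgker f z]]
    exact kernel_comp Q T⁻¹ (fun w : ↥S => f w.1) p
  have hcqg : ∀ (f : Site d → 𝔸) (p : ↥B),
      c (q (g f)) p.1.1 p.1.2 = ∑ w : ↥S, (((Q * T⁻¹ * T⁻¹ * Qᵀ)⁻¹ * (Q * T⁻¹)) p w) • f w.1 := by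
    intro f p
    rw [hcker, Finset.sum_congr rfl fun p' _ => by rw [hqg f p']]
    exact kernel_comp (Q * T⁻¹ * T⁻¹ * Qᵀ)⁻¹ (Q * T⁻¹) (fun w : ↥S => f w.1) p
  have hqs_ker : ∀ (φ : ℕ → Site d → 𝔸) (z : ↥S), qs φ z.1 = ∑ p : ↥B, (Qᵀ z p) • φ p.1.1 p.1.2 := by
    intro φ z
    rw [hqs φ z.1 ((hS z.1).mp z.2), QTZ_flat_apply hLo, tower_sum_eq_bm L n Λs (flmZ L) B hB φ z.1, ← Finset.sum_coe_sort B]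
    exact Finset.sum_congr rfl fun p _ => by rw [Matrix.transpose_apply, hQ, Matrix.of_apply]
  have hqscqg : ∀ (f : Site d → 𝔸) (z : ↥S),
      qs (c (q (g f))) z.1 = ∑ w : ↥S, ((Qᵀ * ((Q * T⁻¹ * T⁻¹ * Qᵀ)⁻¹ * (Q * T⁻¹))) z w) • f w.1 := by
    intro f z
    rw [hqs_ker, Finset.sum_congr rfl fun p _ => by rw [hcqg f p]]
    exact kernel_comp Qᵀ ((Q * T⁻¹ * T⁻¹ * Qᵀ)⁻¹ * (Q * T⁻¹)) (fun w : ↥S => f w.1) z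
  have hR : ∀ (f : Site d → 𝔸) (w : ↥S),
      (fun f => g (qs (c (q (g f))))) f w.1 = ∑ z : ↥S, ((T⁻¹ * (Qᵀ * ((Q * T⁻¹ * T⁻¹ * Qᵀ)⁻¹ * (Q * T⁻¹)))) w z) • f z.1 := by
    intro f w
    show g (qs (c (q (g f)))) w.1 = _
    rw [hgker _ w, Finset.sum_congr rfl fun z _ => by rw [hqscqg f z]]
    exact kernel_comp T⁻¹ (Qᵀ * ((Q * T⁻¹ * T⁻¹ * Qᵀ)⁻¹ * (Q * T⁻¹))) (fun z : ↥S => f z.1) w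
  -- §2 the five bounds by the real-kernel ⊗ id transfer
  have hG := hG_flat_of_real L hη n Ω S hS g T⁻¹ hgker hGsupp realG
  obtain ⟨hH0, hH1, hH2⟩ := hH_flat_of_real L hη n Ω Λs S hS B hB H' (T⁻¹ * (T⁻¹ * Qᵀ) * (Q * T⁻¹ * T⁻¹ * Qᵀ)⁻¹) hHker hHsupp realH
  have hRbd := hRbd_flat_of_real (𝔸 := 𝔸) L n Ω hΩ0 S hS (fun f => g (qs (c (q (g f)))))
    (T⁻¹ * (Qᵀ * ((Q * T⁻¹ * T⁻¹ * Qᵀ)⁻¹ * (Q * T⁻¹)))) hR realR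
  refine ⟨g, Δ, q, qs, Aw, c, H', g_rightΩ, c_range, hΔ, hqs, hq, hH0, hH1, hH2, hHsupp, hHequiv, hQH, hG, hGsupp, ?_, ?_, ?_⟩
  · -- reality of `G′`
    intro f hf
    exact hGreal₀ f (fun x hx => hf 0 (Nat.zero_le _) x hx)
  · -- (1.98)
    intro f r hr hf
    exact hRbd f r hr hf
  · -- reality of `R = 1 − G′QᵀCQG′`
    intro f hf j hj x hx
    rw [Pi.sub_apply]
    exact (hf j hj x hx).sub (hRreal₀ f (fun y hy => hf 0 (Nat.zero_le _) y hy) x)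

end Letters



end Literature.MathematicalPhysics.QuantumFieldTheory.Balaban1983to89.B8Eq191FlatLettersRDOfRealRec

end
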